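import Mathlib.Analysis.SpecialFunctions.Sqrt
import Summits.QuantumFields.BalabanUV.Beta.EriceFlowEnclosureWhitneyCalc
import Summits.QuantumFields.BalabanUV.Beta.EriceFlowEnclosureGClauseCalc

/-!
# Beta / EriceFlowEnclosureWhitneyTower — WHITNEY'S LEMMA ON EVEN FUNCTIONS, PURE SERVICE (II): the transport of a derivative tower
# within `[0, γ]` through `s = g²` — the derivative of `s ↦ ψ₀(√s)` within `[0, γ²]` at `s > 0` AND at `s = 0`, and the transported tower
# with its bounds `k!∕(2k)!·B(2k)` and letters `k!∕(2k)!·ψ_{2k}(0)`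
# (β-flow team, prover 2 = lower ∕ positivity side, unit `b2b-balaban-beta-bflow-p2`, gen 26; part (I) is `EriceFlowEnclosureWhitneyCalc`;
# both serve P2 #43 `EriceFlowEnclosureWhitney`: ROAD (S) = ROAD (G) + PARITY)

HONEST FRAMING (page 1 of everything the β sub-cell writes): discharging `BetaPertH` makes Bałaban's UV stability UNCONDITIONAL — a
real constructive-QFT result; it is NOT the continuum limit and NOT the Clay problem.  HONEST DEPENDENCY (cell reorg 2026-08-19,
verbatim): «continuum YM on T⁴ ⇐ BetaPertH ∧ nine spine estimates (0/9 proved); BetaPertH ⇐ (D1) ∧ (D4) ∧ CAP+tail; G-an2-4 gates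
asym, D1 and NE2/3/4.»  THIS MODULE DISCHARGES NOTHING of that: it is [folklore] one-variable real analysis with NO Erice letter in it —
part (I)'s averaging integrals and Hadamard quotient, the chain rule through `√` away from 0 (Mathlib `Real.hasDerivAt_sqrt`), and the
slope of `s ↦ ψ₀(√s)` at `s = 0`.

THE POINT (H. Whitney, Duke Math. J. 10 (1943) 159–160, quantitative and within a closed interval).  Given a derivative tower `(ψ_j)`
within `[0, γ]` whose ODD levels vanish at 0 (the parity of an even function's jet) with bounds `|ψ_j| ≤ B j`: part (I)'s step
`ψ ↦ (∫₀¹ u^j ψ_{j+2}(u·) du)_j` preserves towers and the parity pattern, divides the bounds by `j + 1`, and its level 0 is the Hadamard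
quotient `ψ₁(g)∕g`.  Iterating it k times (`Ψ_k`) and composing level 0 with `√` gives `H k s = 2^{−k} Ψ_k 0 (√s)`; §1 shows that the
derivative of `s ↦ Ψ_k 0 (√s)` within `[0, γ²]` is `½ Ψ_{k+1} 0 (√s)` — at `s > 0` by the chain rule and the Hadamard quotient, at `s = 0`
by the second-order Hadamard step `ψ₀(g) − ψ₀(0) = g²·∫₀¹ u χ(u g) du` and the continuity of an averaging integral at 0 — so `(H_k)` is
a derivative tower within `[0, γ²]` (§2 `sqrt_tower`), with `|H k| ≤ k!∕(2k)!·B(2k)` (`2ᵏ·k!·1·3⋯(2k−1) = (2k)!`) and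
`H k 0 = k!∕(2k)!·ψ_{2k}(0)`.  P2 #43 feeds it the tower of iterated derivatives within `[0, γ]` of a `C^∞` function with vanishing odd
jet and assembles `s ↦ f(√s)` as a `C^∞` function on `[0, γ²]` (part (I) `contDiffOn_of_tower`).  STATUS: [folklore]; 0 def, 0 sorry;
no Erice ∕ [I] sentence is used or asserted here.

WHAT THIS FILE PROVES:
§1 **`hasDerivWithinAt_sqrt_comp_pos`**, **`hasDerivWithinAt_sqrt_comp_zero`** (the derivative of `s ↦ ψ₀(√s)` within `[0, γ²]` at
   `s > 0` and at `s = 0` is `½·∫₀¹ ψ₂(u√s) du`, along a tower with `ψ₁(0) = 0`).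
§2 `two_pow_mul_factorial_mul_prod_odd` (`2ᵏ·k!·∏_{i<k}(2i+1) = (2k)!`), **`sqrt_tower`** (THE TRANSPORTED TOWER with bounds and letters).
-/

namespace Summit.QuantumFields.BalabanUV.Beta.EriceFlowEnclosureWhitneyTower

open Filter Set Metric MeasureTheory
open scoped Topology Nat
open Summit.QuantumFields.BalabanUV.Beta.EriceFlowEnclosureGClauseCalc (sqrt_mem_Icc)
open Summit.QuantumFields.BalabanUV.Beta.EriceFlowEnclosureWhitneyCalc

noncomputable section

/-! ## §1 The derivative of `s ↦ ψ 0 (√s)` within `[0, γ²]` -/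

/-- **At `s > 0`**: the chain rule through `√` (smooth away from 0) and the Hadamard quotient:
`d∕ds ψ₀(√s) = ψ₁(√s)∕(2√s) = ½·∫₀¹ ψ₂(u√s) du` within `[0, γ²]`. [folklore] -/
theorem hasDerivWithinAt_sqrt_comp_pos {ψ : ℕ → ℝ → ℝ} {γ s : ℝ} (hγ : 0 < γ)
    (hψ : ∀ j, ∀ x ∈ Icc (0 : ℝ) γ, HasDerivWithinAt (ψ j) (ψ (j + 1) x) (Icc 0 γ) x) (h10 : ψ 1 0 = 0)
    (hs : s ∈ Icc (0 : ℝ) (γ ^ 2)) (hs0 : 0 < s) :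
    HasDerivWithinAt (fun s => ψ 0 (Real.sqrt s))
      ((1 / 2) * ∫ u in (0 : ℝ)..1, u ^ 0 * ψ 2 (u * Real.sqrt s)) (Icc 0 (γ ^ 2)) s := by
  have hsq : Real.sqrt s ∈ Icc (0 : ℝ) γ := sqrt_mem_Icc hγ.le hs
  have hsqpos : 0 < Real.sqrt s := Real.sqrt_pos.mpr hs0
  have h1 := hψ 0 (Real.sqrt s) hsq
  have h2 : HasDerivWithinAt Real.sqrt (1 / (2 * Real.sqrt s)) (Icc 0 (γ ^ 2)) s :=
    (Real.hasDerivAt_sqrt hs0.ne').hasDerivWithinAt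
  have hmaps : MapsTo Real.sqrt (Icc 0 (γ ^ 2)) (Icc (0 : ℝ) γ) := fun t ht => sqrt_mem_Icc hγ.le ht
  have h := h1.comp s h2 hmaps
  have e : ψ 1 (Real.sqrt s) * (1 / (2 * Real.sqrt s)) = (1 / 2) * ∫ u in (0 : ℝ)..1, u ^ 0 * ψ 2 (u * Real.sqrt s) := by
    rw [hadamard hψ h10 _ hsq]
    field_simp
  rw [e] at h
  exact h

/-- **At `s = 0`**: `ψ₀(√s) − ψ₀(0) = s·∫₀¹ u χ(u√s) du` with `χ(y) = ∫₀¹ ψ₂(u′ y) du′` (part (I) `sub_eq_sq_mul_avg`), and the averaging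
integral of the continuous `χ` is continuous at 0 within `[0, γ]` (it is even differentiable there, part (I) `hasDerivWithinAt_avg`), so
the slope tends to `χ(0)∕2 = ½·∫₀¹ ψ₂(u·√0) du`. [folklore] -/
theorem hasDerivWithinAt_sqrt_comp_zero {ψ : ℕ → ℝ → ℝ} {γ : ℝ} (hγ : 0 < γ)
    (hψ : ∀ j, ∀ x ∈ Icc (0 : ℝ) γ, HasDerivWithinAt (ψ j) (ψ (j + 1) x) (Icc 0 γ) x) (h10 : ψ 1 0 = 0) :
    HasDerivWithinAt (fun s => ψ 0 (Real.sqrt s))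
      ((1 / 2) * ∫ u in (0 : ℝ)..1, u ^ 0 * ψ 2 (u * Real.sqrt 0)) (Icc 0 (γ ^ 2)) 0 := by
  -- χ and χ′ = ∫₀¹ u ψ₃(u·) du are levels 0, 1 of the averaged tower: differentiable, hence continuous, on [0, γ]
  have hχd : ∀ x ∈ Icc (0 : ℝ) γ, HasDerivWithinAt (fun y => ∫ u' in (0 : ℝ)..1, u' ^ 0 * ψ (0 + 2) (u' * y))
      (∫ u in (0 : ℝ)..1, u ^ (0 + 1) * ψ (0 + 1 + 2) (u * x)) (Icc 0 γ) x :=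
    fun x hx => tower_step hγ hψ 0 x hx
  have hχ'c : ContinuousOn (fun x => ∫ u in (0 : ℝ)..1, u ^ (0 + 1) * ψ (0 + 1 + 2) (u * x)) (Icc 0 γ) :=
    fun x hx => (tower_step hγ hψ (0 + 1) x hx).continuousWithinAt
  -- the averaging integral A₁χ is differentiable, hence continuous, at 0 within [0, γ]
  have hA : ContinuousWithinAt (fun g => ∫ u in (0 : ℝ)..1, u ^ 1 * ∫ u' in (0 : ℝ)..1, u' ^ 0 * ψ 2 (u' * (u * g)))
      (Icc 0 γ) 0 := by
    have h := (hasDerivWithinAt_avg hγ hχd hχ'c 1 0 ⟨le_rfl, hγ.le⟩).continuousWithinAt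
    simpa only using h
  have hA0 : (∫ u in (0 : ℝ)..1, u ^ 1 * ∫ u' in (0 : ℝ)..1, u' ^ 0 * ψ 2 (u' * (u * 0)))
      = (1 / 2) * ∫ u in (0 : ℝ)..1, u ^ 0 * ψ 2 (u * Real.sqrt 0) := by
    have h := avg_zero (fun y => ∫ u' in (0 : ℝ)..1, u' ^ 0 * ψ 2 (u' * y)) 1
    rw [h, Real.sqrt_zero, avg_zero]
    push_cast
    ring
  rw [hasDerivWithinAt_iff_tendsto_slope, ← hA0]
  -- slope = A₁χ ∘ √ on the punctured interval
  have hmaps : MapsTo Real.sqrt (Icc 0 (γ ^ 2) \ {0}) (Icc (0 : ℝ) γ) := fun t ht => sqrt_mem_Icc hγ.le ht.1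
  have hsqrt : ContinuousWithinAt Real.sqrt (Icc 0 (γ ^ 2) \ {0}) 0 := Real.continuous_sqrt.continuousWithinAt
  have hcomp : Tendsto (fun t => ∫ u in (0 : ℝ)..1, u ^ 1 * ∫ u' in (0 : ℝ)..1, u' ^ 0 * ψ 2 (u' * (u * Real.sqrt t)))
      (𝓝[Icc 0 (γ ^ 2) \ {0}] 0)
      (𝓝 (∫ u in (0 : ℝ)..1, u ^ 1 * ∫ u' in (0 : ℝ)..1, u' ^ 0 * ψ 2 (u' * (u * 0)))) := by
    have hA' : ContinuousWithinAt
        (fun g => ∫ u in (0 : ℝ)..1, u ^ 1 * ∫ u' in (0 : ℝ)..1, u' ^ 0 * ψ 2 (u' * (u * g))) (Icc 0 γ) (Real.sqrt 0) := by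
      rw [Real.sqrt_zero]; exact hA
    have h := (hA'.comp hsqrt hmaps).tendsto
    simp only [Function.comp_def, Real.sqrt_zero] at h
    exact h
  refine hcomp.congr' ?_
  filter_upwards [self_mem_nhdsWithin] with t ht
  have ht0 : (t : ℝ) ≠ 0 := ht.2
  have key := sub_eq_sq_mul_avg hψ h10 (Real.sqrt t) (sqrt_mem_Icc hγ.le ht.1)
  rw [Real.sq_sqrt ht.1.1] at key
  rw [slope_def_field, Real.sqrt_zero, sub_zero, key, mul_div_cancel_left₀ _ ht0]

/-! ## §2 The transported tower -/

/-- `2ᵏ·k!·∏_{i<k} (2i+1) = (2k)!`. [folklore] -/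
theorem two_pow_mul_factorial_mul_prod_odd (k : ℕ) :
    (2 : ℝ) ^ k * k ! * ∏ i ∈ Finset.range k, (2 * (i : ℝ) + 1) = (2 * k) ! := by
  induction k with
  | zero => simp
  | succ k ih =>
    rw [Finset.prod_range_succ, Nat.factorial_succ, show 2 * (k + 1) = (2 * k + 1) + 1 by ring,
      Nat.factorial_succ, Nat.factorial_succ]
    push_cast
    rw [← ih]
    ring

/-- **THE TRANSPORTED TOWER (Whitney's mechanism, all orders at once).**  Let `(ψ_j)` be a derivative tower within `[0, γ]` (`0 < γ`)
whose ODD levels vanish at 0 and with `|ψ_j| ≤ B j` on `[0, γ]`.  Then there is a derivative tower `(H_k)` within `[0, γ²]` with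
`H 0 s = ψ 0 (√s)`, `|H k| ≤ k!∕(2k)!·B(2k)` on `[0, γ²]` and `H k 0 = k!∕(2k)!·ψ (2k) 0`.  CONSTRUCTION: `Ψ₀ = ψ`,
`Ψ_{k+1} j = ∫₀¹ u^j Ψ_k (j+2)(u·) du` (a tower again, odd levels vanish again, bounds `B(j+2k)∕∏_{i<k}(j+2i+1)`, letters
`ψ_{j+2k}(0)∕∏_{i<k}(j+2i+1)`), and `H k s = 2^{−k}·Ψ_k 0 (√s)`, whose derivative within `[0, γ²]` is `H (k+1)` by §1. [folklore] -/
theorem sqrt_tower {ψ : ℕ → ℝ → ℝ} {γ : ℝ} {B : ℕ → ℝ} (hγ : 0 < γ)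
    (hψ : ∀ j, ∀ x ∈ Icc (0 : ℝ) γ, HasDerivWithinAt (ψ j) (ψ (j + 1) x) (Icc 0 γ) x)
    (hodd : ∀ j, j % 2 = 1 → ψ j 0 = 0) (hB : ∀ j, ∀ x ∈ Icc (0 : ℝ) γ, |ψ j x| ≤ B j) :
    ∃ H : ℕ → ℝ → ℝ, (∀ s, H 0 s = ψ 0 (Real.sqrt s)) ∧
      (∀ k, ∀ s ∈ Icc (0 : ℝ) (γ ^ 2), HasDerivWithinAt (H k) (H (k + 1) s) (Icc 0 (γ ^ 2)) s) ∧
      (∀ k, ∀ s ∈ Icc (0 : ℝ) (γ ^ 2), |H k s| ≤ (k ! : ℝ) / (2 * k) ! * B (2 * k)) ∧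
      (∀ k, H k 0 = (k ! : ℝ) / (2 * k) ! * ψ (2 * k) 0) := by
  -- the iterates of the step operator, opaque but for their two equations
  obtain ⟨Ψ, hΨ0, hΨs⟩ : ∃ Ψ : ℕ → ℕ → ℝ → ℝ, Ψ 0 = ψ ∧
      ∀ k, Ψ (k + 1) = fun j g => ∫ u in (0 : ℝ)..1, u ^ j * Ψ k (j + 2) (u * g) :=
    ⟨fun k => (fun (φ0 : ℕ → ℝ → ℝ) (j : ℕ) (g : ℝ) => ∫ u in (0 : ℝ)..1, u ^ j * φ0 (j + 2) (u * g))^[k] ψ, rfl,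
      fun k => Function.iterate_succ_apply' _ k ψ⟩
  -- the invariant carried by the iteration
  have inv : ∀ k, (∀ j, ∀ x ∈ Icc (0 : ℝ) γ, HasDerivWithinAt (Ψ k j) (Ψ k (j + 1) x) (Icc 0 γ) x) ∧
      (∀ j, j % 2 = 1 → Ψ k j 0 = 0) ∧
      (∀ j, ∀ x ∈ Icc (0 : ℝ) γ, |Ψ k j x| ≤ B (j + 2 * k) / ∏ i ∈ Finset.range k, ((j : ℝ) + 2 * i + 1)) ∧
      (∀ j, Ψ k j 0 = ψ (j + 2 * k) 0 / ∏ i ∈ Finset.range k, ((j : ℝ) + 2 * i + 1)) := by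
    intro k
    induction k with
    | zero =>
      rw [hΨ0]
      refine ⟨hψ, hodd, fun j x hx => by simpa using hB j x hx, fun j => by simp⟩
    | succ k ih =>
      obtain ⟨ht, ho, hb, hv⟩ := ih
      have hprod : ∀ j : ℕ, (∏ i ∈ Finset.range (k + 1), ((j : ℝ) + 2 * i + 1))
          = ((j : ℝ) + 1) * ∏ i ∈ Finset.range k, (((j + 2 : ℕ) : ℝ) + 2 * i + 1) := by
        intro j
        rw [Finset.prod_range_succ']
        have e1 : ∀ i : ℕ, ((j : ℝ) + 2 * ((i + 1 : ℕ) : ℝ) + 1) = (((j + 2 : ℕ) : ℝ) + 2 * (i : ℝ) + 1) := by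
          intro i; push_cast; ring
        simp only [e1, Nat.cast_zero, mul_zero, add_zero]
        ring
      have hPj : ∀ j : ℕ, (∏ i ∈ Finset.range k, (((j + 2 : ℕ) : ℝ) + 2 * (i : ℝ) + 1)) ≠ 0 :=
        fun j => (Finset.prod_pos fun i _ => by positivity).ne'
      rw [hΨs k]
      refine ⟨fun j x hx => tower_step hγ ht j x hx, fun j hj => ?_, fun j x hx => ?_, fun j => ?_⟩
      · show (∫ u in (0 : ℝ)..1, u ^ j * Ψ k (j + 2) (u * 0)) = 0
        rw [avg_zero, ho (j + 2) (by omega), zero_div]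
      · show |∫ u in (0 : ℝ)..1, u ^ j * Ψ k (j + 2) (u * x)| ≤ _
        refine (abs_avg_le hx (hb (j + 2)) j).trans_eq ?_
        have hne := hPj j
        rw [hprod j, show j + 2 + 2 * k = j + 2 * (k + 1) by ring]
        field_simp
      · show (∫ u in (0 : ℝ)..1, u ^ j * Ψ k (j + 2) (u * 0)) = _
        have hne := hPj j
        rw [avg_zero, hv (j + 2), hprod j, show j + 2 + 2 * k = j + 2 * (k + 1) by ring]
        field_simp
  -- the constants: 2^{-k} ∕ ∏_{i<k}(2i+1) = k! ∕ (2k)!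
  have hP : ∀ k : ℕ, 0 < ∏ i ∈ Finset.range k, (2 * (i : ℝ) + 1) :=
    fun k => Finset.prod_pos fun i _ => by positivity
  have hconst : ∀ k : ℕ, ((1 : ℝ) / 2) ^ k / ∏ i ∈ Finset.range k, (2 * (i : ℝ) + 1) = (k ! : ℝ) / (2 * k) ! := by
    intro k
    have h := two_pow_mul_factorial_mul_prod_odd k
    rw [div_eq_div_iff (hP k).ne' (by positivity), ← h]
    have h2 : ((1 : ℝ) / 2) ^ k * 2 ^ k = 1 := by rw [← mul_pow]; norm_num
    linear_combination ((k ! : ℝ) * ∏ i ∈ Finset.range k, (2 * (i : ℝ) + 1)) * h2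
  refine ⟨fun k s => ((1 : ℝ) / 2) ^ k * Ψ k 0 (Real.sqrt s), fun s => by simp [hΨ0], fun k s hs => ?_,
    fun k s hs => ?_, fun k => ?_⟩
  · -- the tower within [0, γ²]
    obtain ⟨ht, ho, -, -⟩ := inv k
    have h10 : Ψ k 1 0 = 0 := ho 1 rfl
    have e : ((1 : ℝ) / 2) ^ (k + 1) * Ψ (k + 1) 0 (Real.sqrt s)
        = ((1 : ℝ) / 2) ^ k * ((1 / 2) * ∫ u in (0 : ℝ)..1, u ^ 0 * Ψ k 2 (u * Real.sqrt s)) := by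
      rw [hΨs k, pow_succ]
      show _ = _ * (_ * ∫ u in (0 : ℝ)..1, u ^ 0 * Ψ k (0 + 2) (u * Real.sqrt s))
      ring
    show HasDerivWithinAt (fun s => ((1 : ℝ) / 2) ^ k * Ψ k 0 (Real.sqrt s))
      (((1 : ℝ) / 2) ^ (k + 1) * Ψ (k + 1) 0 (Real.sqrt s)) (Icc 0 (γ ^ 2)) s
    rw [e]
    rcases eq_or_lt_of_le hs.1 with h0 | hpos
    · subst h0
      exact (hasDerivWithinAt_sqrt_comp_zero hγ ht h10).const_mul _
    · exact (hasDerivWithinAt_sqrt_comp_pos hγ ht h10 hs hpos).const_mul _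
  · -- the bounds
    obtain ⟨-, -, hb, -⟩ := inv k
    have h := hb 0 (Real.sqrt s) (sqrt_mem_Icc hγ.le hs)
    simp only [Nat.cast_zero, zero_add] at h
    show |((1 : ℝ) / 2) ^ k * Ψ k 0 (Real.sqrt s)| ≤ _
    rw [abs_mul, abs_of_nonneg (by positivity : (0 : ℝ) ≤ (1 / 2) ^ k), ← hconst k]
    calc ((1 : ℝ) / 2) ^ k * |Ψ k 0 (Real.sqrt s)|
        ≤ ((1 : ℝ) / 2) ^ k * (B (2 * k) / ∏ i ∈ Finset.range k, (2 * (i : ℝ) + 1)) :=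
          mul_le_mul_of_nonneg_left h (by positivity)
      _ = ((1 : ℝ) / 2) ^ k / (∏ i ∈ Finset.range k, (2 * (i : ℝ) + 1)) * B (2 * k) := by ring
  · -- the letters at 0
    obtain ⟨-, -, -, hv⟩ := inv k
    show ((1 : ℝ) / 2) ^ k * Ψ k 0 (Real.sqrt 0) = _
    have h := hv 0
    simp only [Nat.cast_zero, zero_add] at h
    rw [Real.sqrt_zero, h, ← hconst k]
    ring

end

end Summit.QuantumFields.BalabanUV.Beta.EriceFlowEnclosureWhitneyTower
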